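import Literature.NumberTheory.ModularForms.Lemma49Minus24
import HarnessLib

/-!
# CKMRV Lemma 4.9 (4.16) for `𝒦₋^{(24)}`: the non-decaying part `𝒢₋^{(24)}` and the bound

Cohn–Kumar–Miller–Radchenko–Viazovska, arXiv:1902.05438, §4.4 and Lemma 4.9 (4.16) with `n_{−,z} = 1`:
`|((𝒦₋^{(24)} − 𝒢₋^{(24)})|^τ_{12}γ)(τ,z)| ≤ C|e^{πiz}τ²z²/(Δ(τ)Δ(z)(j(τ)−j(z)))|`.

For rows `(1, R₂, R₄)`, `N_R = minus24Kernel R·Δ(τ)Δ(z)(j(τ)−j(z))`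
`= c'·[−F_V(τ)W(z) − F_{jV}(τ)(jW)(z) + F_f(τ)((E₁₀/Δ)(U²−V²))(z) + F_L(τ)((E₁₄/Δ)𝓛)(z)]` with the
coefficient functions of `Lemma49Minus24`; the principal parts in `w = e^{−πiz}` of the four `z`-functions
are `1`, `w² − 8w + 768`, `w² + 16w − 384`, `(πiz + log 16)w² − 8w + 12`. Solving for the principal
part of `𝒦 = N/(ΔΔ(j−j))` gives **`𝒢_R = c'(Ĝ₋₂ e^{−2πiz} + Ĝ₀)`** (`minus24G`) with
`Ĝ₋₂ = 3(R₂E₄E₆ − R₄E₄²)(τ) + 3456Δ(τ)(πiz + log 16 − 1)`,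
`Ĝ₀ = −1008R₂E₄E₆ − 720R₄E₄² + 3456E₄³·(πiz + log 16) − 2488320Δ·(πiz + log 16) − 124416Δ`
(no `e^{−πiz}`-term, degree `1` in `z`, as asserted in §4.4). PROVED: the multiplied-out identity
`(minus24Kernel R − 𝒢_R)·ΔΔ(j−j) = c'·M_R` with `M_R` an explicit sum of products each carrying a factor
`O(e^{−π Im z})` (`minus24Kernel_sub_G_mul_eq`), the uniform bounds, and **(4.16) for rows `O(|τ|)`**,
hence for `γ = I, T, TS` (`kernelMinus24_sub_G_bound_416`).

## References

* H. Cohn, A. Kumar, S. D. Miller, D. Radchenko, M. Viazovska, Ann. of Math. 196 (2022),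
  arXiv:1902.05438, §4.4, Lemma 4.9 (4.16). [CohnEtAl2019]
-/

noncomputable section

open Complex hiding I
open Filter Topology Asymptotics ModularForm SlashInvariantForm EisensteinSeries
open UpperHalfPlane hiding I
open Complex (I)
open scoped Real MatrixGroups ModularForm Manifold

namespace Literature.NumberTheory.ModularForms

open Literature.NumberTheory.EllipticCurves.ModularForms (kleinJ kleinJ_smul continuous_kleinJ E₄_cube_eq_kleinJ_mul)

/-! ## Principal parts and `𝒢₋^{(24)}` -/

/-- Principal part of `jW`: `w² − 8w + 768`, `w = e^{−πiz}`. [cite: CohnEtAl2019, Lemma 4.9 (proof)] -/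
def QjW24 (z : ℍ) : ℂ := (qhalf z)⁻¹ ^ 2 - 8 * (qhalf z)⁻¹ + 768
/-- Principal part of `(E₁₀/Δ)(U² − V²)`: `w² + 16w − 384`. [cite: CohnEtAl2019, Lemma 4.9 (proof)] -/
def QfU24 (z : ℍ) : ℂ := (qhalf z)⁻¹ ^ 2 + 16 * (qhalf z)⁻¹ - 384
/-- Principal part of `(E₁₄/Δ)𝓛`: `(πiz + log 16)w² − 8w + 12`. [cite: CohnEtAl2019, Lemma 4.9 (proof)] -/
def QfL24 (z : ℍ) : ℂ := lamLeadZ z * (qhalf z)⁻¹ ^ 2 - 8 * (qhalf z)⁻¹ + 12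

/-- `Ĝ₋₂(τ,z)` (coefficient of `e^{−2πiz}`). [cite: CohnEtAl2019, §4.4] -/
def minus24GhatM2 (R2 R4 : ℍ → ℂ) (τ z : ℍ) : ℂ :=
  3 * (R2 τ * E₄ τ * E₆ τ - R4 τ * E₄ τ ^ 2) + 3456 * ModularForm.discriminant τ * (lamLeadZ z - 1)

/-- `Ĝ₀(τ,z)`. [cite: CohnEtAl2019, §4.4] -/
def minus24Ghat0 (R2 R4 : ℍ → ℂ) (τ z : ℍ) : ℂ :=
  -1008 * (R2 τ * E₄ τ * E₆ τ) - 720 * (R4 τ * E₄ τ ^ 2) + 3456 * E₄ τ ^ 3 * lamLeadZ z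
    - 2488320 * ModularForm.discriminant τ * lamLeadZ z - 124416 * ModularForm.discriminant τ

/-- **`𝒢_R = c'(Ĝ₋₂e^{−2πiz} + Ĝ₀)`** (`𝒢₋^{(24)} = minus24G ψ₂ ψ₄`), `c' = 1/(2·1728·π)`. [cite: CohnEtAl2019, §4.4] -/
def minus24G (R2 R4 : ℍ → ℂ) (τ z : ℍ) : ℂ :=
  1 / (2 * 1728 * (π : ℂ)) * (minus24GhatM2 R2 R4 τ z * (qhalf z)⁻¹ ^ 2 + minus24Ghat0 R2 R4 τ z)

/-- The explicit remainder `M_R`. [cite: CohnEtAl2019, Lemma 4.9 (proof)] -/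
def minus24M (R2 R4 : ℍ → ℂ) (τ z : ℍ) : ℂ :=
  -(FV24 R2 R4 τ * (thetaW z - 1)) - FjV24 R2 R4 τ * (kleinJ z * thetaW z - QjW24 z)
  + Ff24 R2 R4 τ * (fNeg2fun z * psiTilde4 z - QfU24 z) + FL24 τ * (f2fun z * logLambda z - QfL24 z)
  - ( minus24GhatM2 R2 R4 τ z * E₄ τ ^ 3 * (ModularForm.discriminant z * (qhalf z)⁻¹ ^ 2 - 1)
      + minus24Ghat0 R2 R4 τ z * E₄ τ ^ 3 * ModularForm.discriminant z
      - minus24GhatM2 R2 R4 τ z * ModularForm.discriminant τ * (E₄ z ^ 3 * (qhalf z)⁻¹ ^ 2 - (qhalf z)⁻¹ ^ 2 - 720)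
      - minus24Ghat0 R2 R4 τ z * ModularForm.discriminant τ * (E₄ z ^ 3 - 1) )

/-- **The multiplied-out identity** `(minus24Kernel R − 𝒢_R)·Δ(τ)Δ(z)(j(τ)−j(z)) = c'·M_R` off the poles.
[cite: CohnEtAl2019, Lemma 4.9 (proof)] -/
theorem minus24Kernel_sub_G_mul_eq (R2 R4 : ℍ → ℂ) (τ z : ℍ) (hJ : kleinJ τ - kleinJ z ≠ 0) :
    (minus24Kernel R2 R4 τ z - minus24G R2 R4 τ z) *
      (ModularForm.discriminant τ * ModularForm.discriminant z * (kleinJ τ - kleinJ z)) =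
        1 / (2 * 1728 * (π : ℂ)) * minus24M R2 R4 τ z := by
  have hΔz := ModularForm.discriminant_ne_zero z
  have hΔτ := ModularForm.discriminant_ne_zero τ
  have hb := qhalf_ne_zero z
  have hπ : (π : ℂ) ≠ 0 := ofReal_ne_zero.2 Real.pi_ne_zero
  have e1 : kleinJ τ = E₄ τ ^ 3 / ModularForm.discriminant τ := by rw [eq_div_iff hΔτ]; exact (E₄_cube_eq_kleinJ_mul τ).symm
  have e2 : kleinJ z = E₄ z ^ 3 / ModularForm.discriminant z := by rw [eq_div_iff hΔz]; exact (E₄_cube_eq_kleinJ_mul z).symm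
  simp only [minus24Kernel, minus24G, minus24M, minus24GhatM2, minus24Ghat0, QjW24, QfU24, QfL24, FV24, FjV24, Ff24, FL24,
    psiTilde0, psiTilde2, E8fun, E10fun, Pi.mul_apply]
  field_simp
  rw [e1, e2]
  field_simp
  ring

/-- `norm_minus24Kernel_sub_G_mul_le` (auxiliary). [cite: CohnEtAl2019, Lemma 4.9 (proof)] -/
theorem norm_minus24Kernel_sub_G_mul_le (R2 R4 : ℍ → ℂ) (τ z : ℍ) :
    ‖(minus24Kernel R2 R4 τ z - minus24G R2 R4 τ z) *
      (ModularForm.discriminant τ * ModularForm.discriminant z * (kleinJ τ - kleinJ z))‖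
        ≤ ‖1 / (2 * 1728 * (π : ℂ))‖ * ‖minus24M R2 R4 τ z‖ := by
  by_cases hJ : kleinJ τ - kleinJ z = 0
  · rw [hJ]; simp
  · rw [minus24Kernel_sub_G_mul_eq R2 R4 τ z hJ, norm_mul]

/-! ## The `z`-factors of `M_R` are `O(|z|e^{−π Im z})` -/

/-- Uniform inputs on half-planes: `q(E₁₀/Δ) − 1 + 240q = O(b⁴)`, `q(E₁₄/Δ) − 1 = O(b⁴)`, `j − 1/q − 744 = O(b²)`,
`Δ/q − 1, E₄³/q − 1/q − 720 = O(b²)` (with `1/q = w²`). [cite: CohnEtAl2019, Lemma 4.9 (proof)] -/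
theorem minus24G_inputs_halfPlane {δ : ℝ} (hδ : 0 < δ) :
    ((fun z : ℍ => qfun z * fNeg2fun z - 1 + 240 * qfun z) =O[𝓟 (halfPlane δ)] fun z => expDecayHalf z ^ 4) ∧
    ((fun z : ℍ => qfun z * f2fun z - 1) =O[𝓟 (halfPlane δ)] fun z => expDecayHalf z ^ 4) ∧
    ((fun z : ℍ => kleinJ z - (qhalf z)⁻¹ ^ 2 - 744) =O[𝓟 (halfPlane δ)] fun z => expDecayHalf z ^ 2) ∧
    ((fun z : ℍ => ModularForm.discriminant z * (qhalf z)⁻¹ ^ 2 - 1) =O[𝓟 (halfPlane δ)] fun z => expDecayHalf z ^ 2) ∧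
    ((fun z : ℍ => E₄ z ^ 3 * (qhalf z)⁻¹ ^ 2 - (qhalf z)⁻¹ ^ 2 - 720) =O[𝓟 (halfPlane δ)] fun z => expDecayHalf z ^ 2) := by
  obtain ⟨_, _, _, s4c, _, s5b, r1, r2⟩ := scalar24_isBigO_halfPlane hδ
  have hw2 : ∀ z : ℍ, (qhalf z)⁻¹ ^ 2 = (qfun z)⁻¹ := fun z => by rw [← qhalf_sq, inv_pow]
  have e2 : ∀ z : ℍ, expDecay z = expDecayHalf z ^ 2 := expDecay_eq_sq
  have hq : (fun τ : ℍ => qfun τ) =O[𝓟 (halfPlane δ)] expDecay := by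
    rw [isBigO_principal]; exact ⟨1, fun τ _ => by rw [norm_qfun, Real.norm_of_nonneg (expDecay_pos τ).le, one_mul]⟩
  refine ⟨?_, ?_, s4c.congr (fun z => by rw [hw2]) (fun z => e2 z), r1.congr (fun z => by rw [hw2]) (fun z => e2 z),
    r2.congr (fun z => by rw [hw2]) (fun z => e2 z)⟩
  · have := isBigO_halfPlane_of_two_periodic (G := fun z : ℍ => qfun z * fNeg2fun z - 1 + 240 * qfun z) (by fun_prop)
      (fun τ => by simp only [qfun_vadd_two, fNeg2fun_vadd_two]) 2 qfun_mul_fNeg2fun_second_order hδ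
    exact this.congr_right fun z => by rw [e2]; ring
  · have := hq.mul s5b
    exact this.congr (fun z => by have := qfun_ne_zero z; field_simp) (fun z => by rw [e2]; ring)

/-- The `z`-factors of `M_R` are `O(|z|e^{−π Im z})` on half-planes. [cite: CohnEtAl2019, Lemma 4.9 (proof)] -/
theorem zSide24minus_isBigO {δ : ℝ} (hδ : 0 < δ) :
    ((fun z => thetaW z - 1) =O[𝓟 (halfPlane δ)] fun z : ℍ => ‖(z : ℂ)‖ * expDecayHalf z) ∧
    ((fun z => kleinJ z * thetaW z - QjW24 z) =O[𝓟 (halfPlane δ)] fun z : ℍ => ‖(z : ℂ)‖ * expDecayHalf z) ∧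
    ((fun z => fNeg2fun z * psiTilde4 z - QfU24 z) =O[𝓟 (halfPlane δ)] fun z : ℍ => ‖(z : ℂ)‖ * expDecayHalf z) ∧
    ((fun z => f2fun z * logLambda z - QfL24 z) =O[𝓟 (halfPlane δ)] fun z : ℍ => ‖(z : ℂ)‖ * expDecayHalf z) ∧
    ((fun z : ℍ => (lamLeadZ z - 1) * (ModularForm.discriminant z * (qhalf z)⁻¹ ^ 2 - 1)) =O[𝓟 (halfPlane δ)]
        fun z : ℍ => ‖(z : ℂ)‖ * expDecayHalf z) ∧
    ((fun z : ℍ => ModularForm.discriminant z * (qhalf z)⁻¹ ^ 2 - 1) =O[𝓟 (halfPlane δ)] fun z : ℍ => ‖(z : ℂ)‖ * expDecayHalf z) ∧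
    ((fun z : ℍ => lamLeadZ z * ModularForm.discriminant z) =O[𝓟 (halfPlane δ)] fun z : ℍ => ‖(z : ℂ)‖ * expDecayHalf z) ∧
    ((ModularForm.discriminant : ℍ → ℂ) =O[𝓟 (halfPlane δ)] fun z : ℍ => ‖(z : ℂ)‖ * expDecayHalf z) ∧
    ((fun z : ℍ => (lamLeadZ z - 1) * (E₄ z ^ 3 * (qhalf z)⁻¹ ^ 2 - (qhalf z)⁻¹ ^ 2 - 720)) =O[𝓟 (halfPlane δ)]
        fun z : ℍ => ‖(z : ℂ)‖ * expDecayHalf z) ∧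
    ((fun z : ℍ => E₄ z ^ 3 * (qhalf z)⁻¹ ^ 2 - (qhalf z)⁻¹ ^ 2 - 720) =O[𝓟 (halfPlane δ)] fun z : ℍ => ‖(z : ℂ)‖ * expDecayHalf z) ∧
    ((fun z : ℍ => lamLeadZ z * (E₄ z ^ 3 - 1)) =O[𝓟 (halfPlane δ)] fun z : ℍ => ‖(z : ℂ)‖ * expDecayHalf z) ∧
    ((fun z : ℍ => E₄ z ^ 3 - 1) =O[𝓟 (halfPlane δ)] fun z : ℍ => ‖(z : ℂ)‖ * expDecayHalf z) := by
  obtain ⟨ifm, if2, ij, iD, iE⟩ := minus24G_inputs_halfPlane hδ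
  obtain ⟨⟨CU, hU⟩, ⟨CW, hW⟩, ⟨CV, hV⟩⟩ := thetaUVW_uniform hδ
  obtain ⟨_, ⟨CM, hM⟩⟩ := logLambda_uniform hδ
  obtain ⟨hU1, hW1, hVb, _, _, hM1, _, _, _, _, _, _⟩ := halfPlane_isBigO_theta hδ
  obtain ⟨_, _, _, hΔ, hE4, _, _, h1, hcoe, hq1⟩ := halfPlane_isBigO_basic hδ
  obtain ⟨_, _, _, _, _, _, _, _, z43, _, _⟩ := halfPlane_isBigO_factors hδ
  set l := 𝓟 (halfPlane δ)
  have hb0 : ∀ τ : ℍ, 0 ≤ expDecayHalf τ := fun τ => (expDecayHalf_pos τ).le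
  have mk : ∀ {f : ℍ → ℂ} (C : ℝ) (n : ℕ), (∀ τ : ℍ, δ ≤ τ.im → ‖f τ‖ ≤ C * expDecayHalf τ ^ n) →
      f =O[l] fun τ => expDecayHalf τ ^ n := by
    intro f C n h
    rw [isBigO_principal]
    exact ⟨C, fun τ hτ => by rw [Real.norm_of_nonneg (pow_nonneg (hb0 τ) n)]; exact h τ hτ⟩
  have rU := mk CU 4 hU
  have rW := mk CW 4 hW
  have rV := mk CV 5 hV
  have rM := mk CM 3 hM
  have hb : qhalf =O[l] expDecayHalf := by
    rw [isBigO_principal]; exact ⟨1, fun τ _ => by rw [norm_qhalf, Real.norm_of_nonneg (hb0 τ), one_mul]⟩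
  have hbp : ∀ n : ℕ, (fun τ => qhalf τ ^ n) =O[l] fun τ => expDecayHalf τ ^ n := fun n => hb.pow n
  have pw : ∀ {m n : ℕ}, n ≤ m → (fun τ => expDecayHalf τ ^ m) =O[l] fun τ => expDecayHalf τ ^ n := by
    intro m n h
    rw [isBigO_principal]; exact ⟨1, fun τ _ => by
      rw [Real.norm_of_nonneg (pow_nonneg (hb0 τ) _), Real.norm_of_nonneg (pow_nonneg (hb0 τ) _), one_mul]
      exact pow_le_pow_of_le_one (hb0 τ) (expDecayHalf_le_one τ) h⟩
  have hbp1 : ∀ n : ℕ, (fun τ => qhalf τ ^ n) =O[l] fun _ : ℍ => (1 : ℝ) := fun n =>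
    ((hbp n).trans (pw (Nat.zero_le n))).congr_right fun τ => pow_zero _
  have hb1 : qhalf =O[l] fun _ : ℍ => (1 : ℝ) := (hbp1 1).congr_left fun τ => pow_one _
  have one1 : (fun _ : ℍ => (1 : ℂ)) =O[l] fun _ : ℍ => (1 : ℝ) := isBigO_const_const (1 : ℂ) (one_ne_zero : (1:ℝ) ≠ 0) _
  have hV1 : thetaV =O[l] fun _ : ℍ => (1 : ℝ) := hVb.trans ((pw (Nat.zero_le 1)).congr (fun τ => pow_one _) (fun τ => pow_zero _))
  -- inverse powers of `b`
  have hw : (fun z : ℍ => (qhalf z)⁻¹ ^ 2) =O[l] fun z => (expDecayHalf z)⁻¹ ^ 2 := by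
    rw [isBigO_principal]; exact ⟨1, fun τ _ => by
      rw [norm_pow, norm_inv, norm_qhalf, Real.norm_of_nonneg (pow_nonneg (inv_nonneg.2 (hb0 τ)) _), one_mul]⟩
  -- `w²·O(b^{n+2}) = O(b^n)`
  have divw : ∀ {f : ℍ → ℂ} {n : ℕ}, f =O[l] (fun z => expDecayHalf z ^ (n + 2)) →
      (fun z => (qhalf z)⁻¹ ^ 2 * f z) =O[l] fun z => expDecayHalf z ^ n := by
    intro f n hf
    have := hw.mul hf
    refine this.congr_right fun z => ?_
    have hp : expDecayHalf z ≠ 0 := (expDecayHalf_pos z).ne'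
    field_simp
    ring
  have divw' : ∀ {f : ℍ → ℂ} {n : ℕ}, f =O[l] (fun z : ℍ => ‖(z : ℂ)‖ * expDecayHalf z ^ (n + 2)) →
      (fun z => (qhalf z)⁻¹ ^ 2 * f z) =O[l] fun z : ℍ => ‖(z : ℂ)‖ * expDecayHalf z ^ n := by
    intro f n hf
    have := hw.mul hf
    refine this.congr_right fun z => ?_
    have hp : expDecayHalf z ≠ 0 := (expDecayHalf_pos z).ne'
    field_simp
    ring
  -- theta heads (third order suffices)
  have hU3 : (fun τ => thetaU τ - (1 + 8 * qhalf τ + 24 * qhalf τ ^ 2)) =O[l] fun τ => expDecayHalf τ ^ 3 := by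
    have := (rU.trans (pw (by norm_num : 3 ≤ 4))).add ((hbp 3).const_mul_left 32)
    exact this.congr_left fun τ => by ring
  have hW3 : (fun τ => thetaW τ - 1 + 8 * qhalf τ - 24 * qhalf τ ^ 2) =O[l] fun τ => expDecayHalf τ ^ 3 := by
    have := (rW.trans (pw (by norm_num : 3 ≤ 4))).sub ((hbp 3).const_mul_left 32)
    exact this.congr_left fun τ => by ring
  have hV3 : (fun τ => thetaV τ - 16 * qhalf τ) =O[l] fun τ => expDecayHalf τ ^ 3 := by
    have := (rV.trans (pw (by norm_num : 3 ≤ 5))).add ((hbp 3).const_mul_left 64)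
    exact this.congr_left fun τ => by ring
  have hWm1 : (fun z => thetaW z - 1) =O[l] expDecayHalf := by
    have t2 : (fun τ => qhalf τ ^ 2) =O[l] expDecayHalf := ((hbp 2).trans (pw (by norm_num : 1 ≤ 2))).congr_right fun τ => pow_one _
    have := ((hW3.trans (pw (by norm_num : 1 ≤ 3)) |>.congr_right fun τ => pow_one _).sub (hb.const_mul_left 8)).add (t2.const_mul_left 24)
    exact this.congr_left fun τ => by ring
  -- lifting `O(b) ⊂ O(|z| b)`
  have up : ∀ {f : ℍ → ℂ}, f =O[l] expDecayHalf → f =O[l] fun z : ℍ => ‖(z : ℂ)‖ * expDecayHalf z := by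
    intro f hf; simpa using h1.mul hf
  have upn : ∀ {f : ℍ → ℂ} {n : ℕ}, f =O[l] (fun z => expDecayHalf z ^ n) → f =O[l] fun z : ℍ => ‖(z : ℂ)‖ * expDecayHalf z ^ n := by
    intro f n hf; simpa using h1.mul hf
  -- `Λ_z = O(|z|)`, `𝓛 = O(|z|)`
  have hΛ : lamLeadZ =O[l] fun z : ℍ => ‖(z : ℂ)‖ := by
    have t1 : (fun z : ℍ => (π * I * z : ℂ)) =O[l] fun z : ℍ => ‖(z : ℂ)‖ := by simpa using hcoe.const_mul_left (π * I : ℂ)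
    have t2 : (fun _ : ℍ => ((Real.log 16 : ℝ) : ℂ)) =O[l] fun z : ℍ => ‖(z : ℂ)‖ := by
      simpa using h1.const_mul_left (((Real.log 16 : ℝ)) : ℂ)
    exact (t1.add t2).congr_left fun z => by simp [lamLeadZ]
  have hΛ1 : (fun z => lamLeadZ z - 1) =O[l] fun z : ℍ => ‖(z : ℂ)‖ := hΛ.sub (h1.trans (isBigO_refl _ _) |>.congr_left fun _ => rfl)
  have hL : logLambda =O[l] fun z : ℍ => ‖(z : ℂ)‖ := by
    have t1 : (fun z : ℍ => (π * I * z : ℂ)) =O[l] fun z : ℍ => ‖(z : ℂ)‖ := by simpa using hcoe.const_mul_left (π * I : ℂ)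
    have t2 : logLambdaPer =O[l] fun z : ℍ => ‖(z : ℂ)‖ := by simpa using h1.mul hM1
    exact (t1.add t2).congr_left fun z => by simp [logLambdaPer]
  -- (b): `jW − Q = (j − w² − 744)W + w²(W − 1 + 8b − 24b²) + 744(W − 1)`
  have Rb : (fun z => kleinJ z * thetaW z - QjW24 z) =O[l] fun z : ℍ => ‖(z : ℂ)‖ * expDecayHalf z := by
    have t1 : (fun z => (kleinJ z - (qhalf z)⁻¹ ^ 2 - 744) * thetaW z) =O[l] expDecayHalf := by
      have := ij.mul hW1
      exact (this.trans ((pw (by norm_num : 1 ≤ 2)).congr (fun z => by ring) (fun z => pow_one _)))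
    have t2 : (fun z => (qhalf z)⁻¹ ^ 2 * (thetaW z - 1 + 8 * qhalf z - 24 * qhalf z ^ 2)) =O[l] expDecayHalf :=
      (divw (n := 1) hW3).congr_right fun z => pow_one _
    have t3 : (fun z => 744 * (thetaW z - 1)) =O[l] expDecayHalf := hWm1.const_mul_left 744
    have := up ((t1.add t2).add t3)
    refine this.congr_left fun z => ?_
    have hbz := qhalf_ne_zero z
    simp only [QjW24]
    field_simp
    ring
  -- (c): `f₋₂ψ̃₄ − Q = w²[(qf₋₂ − 1 + 240q)(U²−V²) + (1 − 240b²)((U−P)(U+P) − (V−16b)(V+16b) + 384b³ + 576b⁴) − 3840b³ + 34560b⁴]`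
  have Rc : (fun z => fNeg2fun z * psiTilde4 z - QfU24 z) =O[l] fun z : ℍ => ‖(z : ℂ)‖ * expDecayHalf z := by
    have hUV1 : (fun z => thetaU z ^ 2 - thetaV z ^ 2) =O[l] fun _ : ℍ => (1 : ℝ) := by
      have := (hU1.mul hU1).sub (hV1.mul hV1); simpa [sq] using this
    have t1 : (fun z => (qfun z * fNeg2fun z - 1 + 240 * qfun z) * (thetaU z ^ 2 - thetaV z ^ 2)) =O[l] fun z => expDecayHalf z ^ 3 := by
      have := (ifm.trans (pw (by norm_num : 3 ≤ 4))).mul hUV1; simpa using this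
    have hP1 : (fun z : ℍ => 1 + 8 * qhalf z + 24 * qhalf z ^ 2) =O[l] fun _ : ℍ => (1 : ℝ) :=
      (one1.add (hb1.const_mul_left 8)).add ((hbp1 2).const_mul_left 24)
    have t2a : (fun z => (thetaU z - (1 + 8 * qhalf z + 24 * qhalf z ^ 2)) * (thetaU z + (1 + 8 * qhalf z + 24 * qhalf z ^ 2))) =O[l]
        fun z => expDecayHalf z ^ 3 := by simpa using hU3.mul (hU1.add hP1)
    have t2b : (fun z => (thetaV z - 16 * qhalf z) * (thetaV z + 16 * qhalf z)) =O[l] fun z => expDecayHalf z ^ 3 := by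
      simpa using hV3.mul (hV1.add (hb1.const_mul_left 16))
    have t2c : (fun z => 384 * qhalf z ^ 3 + 576 * qhalf z ^ 4) =O[l] fun z => expDecayHalf z ^ 3 :=
      ((hbp 3).const_mul_left 384).add (((hbp 4).trans (pw (by norm_num : 3 ≤ 4))).const_mul_left 576)
    have hin : (fun z => (thetaU z - (1 + 8 * qhalf z + 24 * qhalf z ^ 2)) * (thetaU z + (1 + 8 * qhalf z + 24 * qhalf z ^ 2))
        - (thetaV z - 16 * qhalf z) * (thetaV z + 16 * qhalf z) + (384 * qhalf z ^ 3 + 576 * qhalf z ^ 4)) =O[l]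
        fun z => expDecayHalf z ^ 3 := (t2a.sub t2b).add t2c
    have hbd : (fun z : ℍ => 1 - 240 * qhalf z ^ 2) =O[l] fun _ : ℍ => (1 : ℝ) := one1.sub ((hbp1 2).const_mul_left 240)
    have t2 : (fun z => (1 - 240 * qhalf z ^ 2) * ((thetaU z - (1 + 8 * qhalf z + 24 * qhalf z ^ 2)) * (thetaU z + (1 + 8 * qhalf z + 24 * qhalf z ^ 2))
        - (thetaV z - 16 * qhalf z) * (thetaV z + 16 * qhalf z) + (384 * qhalf z ^ 3 + 576 * qhalf z ^ 4))) =O[l]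
        fun z => expDecayHalf z ^ 3 := by simpa using hbd.mul hin
    have t3 : (fun z => -3840 * qhalf z ^ 3 + 34560 * qhalf z ^ 4) =O[l] fun z => expDecayHalf z ^ 3 :=
      ((hbp 3).const_mul_left (-3840)).add (((hbp 4).trans (pw (by norm_num : 3 ≤ 4))).const_mul_left 34560)
    have := up ((divw (n := 1) ((t1.add t2).add t3)).congr_right fun z => pow_one _)
    refine this.congr_left fun z => ?_
    have hbz := qhalf_ne_zero z
    have hq : qfun z = qhalf z ^ 2 := (qhalf_sq z).symm
    simp only [QfU24, psiTilde4, Pi.sub_apply, Pi.mul_apply, hq]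
    field_simp
    ring
  -- (d): `f₂𝓛 − Q = w²[(qf₂ − 1)𝓛 + (M' + 8b − 12b²)]`, `M' = 𝓛 − Λ_z`
  have Rd : (fun z => f2fun z * logLambda z - QfL24 z) =O[l] fun z : ℍ => ‖(z : ℂ)‖ * expDecayHalf z := by
    have t1 : (fun z => (qfun z * f2fun z - 1) * logLambda z) =O[l] fun z : ℍ => ‖(z : ℂ)‖ * expDecayHalf z ^ 3 := by
      have := (if2.trans (pw (by norm_num : 3 ≤ 4))).mul hL
      exact this.congr_right fun z => by ring
    have t2 : (fun z => logLambdaPer z - (Real.log 16 : ℝ) + 8 * qhalf z - 12 * qhalf z ^ 2) =O[l] fun z : ℍ => ‖(z : ℂ)‖ * expDecayHalf z ^ 3 :=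
      upn rM
    have := (divw' (n := 1) (t1.add t2)).congr_right fun z => by rw [pow_one]
    refine this.congr_left fun z => ?_
    have hbz := qhalf_ne_zero z
    have hq : qfun z = qhalf z ^ 2 := (qhalf_sq z).symm
    simp only [QfL24, logLambdaPer, lamLeadZ, hq]
    field_simp
    ring
  -- (e): the `R'`-pieces
  have iD1 : (fun z : ℍ => ModularForm.discriminant z * (qhalf z)⁻¹ ^ 2 - 1) =O[l] expDecayHalf :=
    (iD.trans (pw (by norm_num : 1 ≤ 2))).congr_right fun z => pow_one _
  have iE1 : (fun z : ℍ => E₄ z ^ 3 * (qhalf z)⁻¹ ^ 2 - (qhalf z)⁻¹ ^ 2 - 720) =O[l] expDecayHalf :=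
    (iE.trans (pw (by norm_num : 1 ≤ 2))).congr_right fun z => pow_one _
  have hqb : expDecay =O[l] expDecayHalf := (pw (by norm_num : 1 ≤ 2)).congr (fun z => (expDecay_eq_sq z).symm) (fun z => pow_one _)
  have hΔb : (ModularForm.discriminant : ℍ → ℂ) =O[l] expDecayHalf := hΔ.trans hqb
  have z43b : (fun z : ℍ => E₄ z ^ 3 - 1) =O[l] expDecayHalf := z43.trans hqb
  exact ⟨up hWm1, Rb, Rc, Rd, hΛ1.mul iD1, up iD1, hΛ.mul hΔb, up hΔb, hΛ1.mul iE1, up iE1, hΛ.mul z43b, up z43b⟩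

/-- **`M_R = O(|τ|·|z|·e^{−π Im z})`** on the product of half-planes, for rows `O(|τ|)`.
[cite: CohnEtAl2019, Lemma 4.9 (4.16)] -/
theorem minus24M_isBigO {δ : ℝ} (hδ : 0 < δ) {R2 R4 : ℍ → ℂ}
    (h2 : R2 =O[𝓟 (halfPlane δ)] fun τ : ℍ => ‖(τ : ℂ)‖) (h4 : R4 =O[𝓟 (halfPlane δ)] fun τ : ℍ => ‖(τ : ℂ)‖) :
    (fun p : ℍ × ℍ => minus24M R2 R4 p.1 p.2) =O[𝓟 (halfPlane δ ×ˢ halfPlane δ)]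
      fun p => ‖(p.1 : ℂ)‖ * (‖(p.2 : ℂ)‖ * expDecayHalf p.2) := by
  obtain ⟨_, _, _, hΔ, hE4, hE6, _, h1, _, hq1⟩ := halfPlane_isBigO_basic hδ
  obtain ⟨w1, w2, w3, w4, w5, w6, w7, w8, w9, w10, w11, w12⟩ := zSide24minus_isBigO hδ
  set F := 𝓟 (halfPlane δ ×ˢ halfPlane δ)
  set l := 𝓟 (halfPlane δ)
  have bb : ∀ {u v : ℍ → ℂ}, u =O[l] (fun _ : ℍ => (1 : ℝ)) → v =O[l] (fun _ : ℍ => (1 : ℝ)) →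
      (fun τ => u τ * v τ) =O[l] fun _ : ℍ => (1 : ℝ) := fun hu hv => by simpa using hu.mul hv
  have hΔ1 : (ModularForm.discriminant : ℍ → ℂ) =O[l] fun _ : ℍ => (1 : ℝ) := hΔ.trans hq1
  have hE4_2 : (fun τ : ℍ => E₄ τ ^ 2) =O[l] fun _ : ℍ => (1 : ℝ) := by simpa [sq] using bb hE4 hE4
  have hE4_3 : (fun τ : ℍ => E₄ τ ^ 3) =O[l] fun _ : ℍ => (1 : ℝ) := by simpa [pow_succ] using bb hE4_2 hE4
  have hE10 : E10fun =O[l] fun _ : ℍ => (1 : ℝ) := (bb hE4 hE6).congr_left fun τ => by simp [E10fun]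
  have hE8 : E8fun =O[l] fun _ : ℍ => (1 : ℝ) := (bb hE4 hE4).congr_left fun τ => by simp [E8fun]
  have RB : ∀ {R u : ℍ → ℂ}, R =O[l] (fun τ : ℍ => ‖(τ : ℂ)‖) → u =O[l] (fun _ : ℍ => (1 : ℝ)) →
      (fun τ => R τ * u τ) =O[l] fun τ : ℍ => ‖(τ : ℂ)‖ := fun hR hu => by simpa using hR.mul hu
  have B1 : ∀ {u : ℍ → ℂ}, u =O[l] (fun _ : ℍ => (1 : ℝ)) → u =O[l] fun τ : ℍ => ‖(τ : ℂ)‖ := fun hu => by simpa using h1.mul hu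
  -- the coefficient functions are `O(|τ|)`
  have hX : (fun τ => R2 τ * E10fun τ - R4 τ * E8fun τ) =O[l] fun τ : ℍ => ‖(τ : ℂ)‖ := (RB h2 hE10).sub (RB h4 hE8)
  have fV : FV24 R2 R4 =O[l] fun τ : ℍ => ‖(τ : ℂ)‖ := by
    have t1 := (B1 (bb hΔ1 hE4_3)).const_mul_left (2 * 1728)
    have t2 := ((RB h2 hE10).mul hE4_3).const_mul_left 3
    have t3 := (RB h4 hE8).mul ((hE4_3.const_mul_left 3).sub (hΔ1.const_mul_left 1728))
    have := (t1.sub (by simpa using t2)).add (by simpa using t3)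
    exact this.congr_left fun τ => by simp only [FV24]; ring
  have fjV : FjV24 R2 R4 =O[l] fun τ : ℍ => ‖(τ : ℂ)‖ := by
    have := (hΔ1.mul ((B1 hΔ1).const_mul_left (-1728) |>.add hX)).const_mul_left 2
    exact this.congr (fun τ => by simp only [FjV24]; ring) (fun τ => by simp)
  have ff : Ff24 R2 R4 =O[l] fun τ : ℍ => ‖(τ : ℂ)‖ := by
    have := (hΔ1.mul hX).neg_left
    exact this.congr (fun τ => by simp only [Ff24]) (fun τ => by simp)
  have fL : FL24 =O[l] fun τ : ℍ => ‖(τ : ℂ)‖ := by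
    have := (B1 (bb hΔ1 hΔ1)).const_mul_left (-2 * 1728)
    exact this.congr_left fun τ => by simp only [FL24]; ring
  -- `Ĝ₋₂ = A(τ) + B(τ)(Λ_z − 1)`, `Ĝ₀ = C(τ) + D(τ)Λ_z`
  have hA : (fun τ => 3 * (R2 τ * E₄ τ * E₆ τ - R4 τ * E₄ τ ^ 2)) =O[l] fun τ : ℍ => ‖(τ : ℂ)‖ := by
    have := ((RB h2 (bb hE4 hE6)).sub (RB h4 hE4_2)).const_mul_left 3
    exact this.congr_left fun τ => by ring
  have hB : (fun τ => 3456 * ModularForm.discriminant τ) =O[l] fun τ : ℍ => ‖(τ : ℂ)‖ := (B1 hΔ1).const_mul_left 3456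
  have hC : (fun τ => -1008 * (R2 τ * E₄ τ * E₆ τ) - 720 * (R4 τ * E₄ τ ^ 2) - 124416 * ModularForm.discriminant τ) =O[l]
      fun τ : ℍ => ‖(τ : ℂ)‖ := by
    have := (((RB h2 (bb hE4 hE6)).const_mul_left (-1008)).sub ((RB h4 hE4_2).const_mul_left 720)).sub ((B1 hΔ1).const_mul_left 124416)
    exact this.congr_left fun τ => by ring
  have hD : (fun τ => 3456 * E₄ τ ^ 3 - 2488320 * ModularForm.discriminant τ) =O[l] fun τ : ℍ => ‖(τ : ℂ)‖ :=
    ((B1 hE4_3).const_mul_left 3456).sub ((B1 hΔ1).const_mul_left 2488320)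
  have T : ∀ {a g : ℍ → ℂ}, a =O[l] (fun τ : ℍ => ‖(τ : ℂ)‖) →
      g =O[l] (fun z : ℍ => ‖(z : ℂ)‖ * expDecayHalf z) →
      (fun p : ℍ × ℍ => a p.1 * g p.2) =O[F] fun p => ‖(p.1 : ℂ)‖ * (‖(p.2 : ℂ)‖ * expDecayHalf p.2) :=
    fun ha hg => (isBigO_fst_of_halfPlane ha).mul (isBigO_snd_of_halfPlane hg)
  have s1 := T fV w1
  have s2 := T fjV w2
  have s3 := T ff w3
  have s4 := T fL w4
  have g1 := T (RB hA hE4_3) w6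
  have g2 := T (RB hB hE4_3) w5
  have g3 := T (RB hC hE4_3) w8
  have g4 := T (RB hD hE4_3) w7
  have g5 := T (RB hA hΔ1) w10
  have g6 := T (RB hB hΔ1) w9
  have g7 := T (RB hC hΔ1) w12
  have g8 := T (RB hD hΔ1) w11
  have total := (((s1.neg_left.sub s2).add s3).add s4).sub ((((g1.add g2).add (g3.add g4)).sub (g5.add g6)).sub (g7.add g8))
  refine total.congr_left fun p => ?_
  simp only [minus24M, minus24GhatM2, minus24Ghat0]
  ring

/-- Conversion to the printed shape. [folklore] -/
theorem minus24Kernel_sub_G_bound_of_isBigO {δ : ℝ} {R2 R4 : ℍ → ℂ} {w : ℍ × ℍ → ℝ} (hw : ∀ p, 0 ≤ w p)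
    (hO : (fun p : ℍ × ℍ => minus24M R2 R4 p.1 p.2) =O[𝓟 (halfPlane δ ×ˢ halfPlane δ)] w) :
    ∃ C : ℝ, ∀ τ z : ℍ, δ ≤ τ.im → δ ≤ z.im →
      ‖(minus24Kernel R2 R4 τ z - minus24G R2 R4 τ z) *
        (ModularForm.discriminant τ * ModularForm.discriminant z * (kleinJ τ - kleinJ z))‖ ≤ C * w (τ, z) := by
  obtain ⟨C, hC⟩ := isBigO_principal.1 hO
  refine ⟨‖1 / (2 * 1728 * (π : ℂ))‖ * |C|, fun τ z hτ hz => (norm_minus24Kernel_sub_G_mul_le R2 R4 τ z).trans ?_⟩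
  have h := hC (τ, z) ⟨hτ, hz⟩
  rw [Real.norm_of_nonneg (hw _)] at h
  have h2 : ‖minus24M R2 R4 τ z‖ ≤ |C| * w (τ, z) := h.trans (mul_le_mul_of_nonneg_right (le_abs_self C) (hw _))
  calc _ ≤ ‖1 / (2 * 1728 * (π : ℂ))‖ * (|C| * w (τ, z)) := mul_le_mul_of_nonneg_left h2 (norm_nonneg _)
    _ = _ := by ring

/-- **Lemma 4.9 (4.16) for `𝒦₋^{(24)}|₁₂γ`, `γ ∈ {I, T, TS}`** (multiplied-out; the rows of `(𝒦 − 𝒢)|γ` are `ψ|γ`,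
`𝒢 = minus24G (ψ₂|γ) (ψ₄|γ)`): on `Im τ, Im z ≥ δ`,
`‖((𝒦₋^{(24)}|₁₂γ)(τ,z) − 𝒢(τ,z))·Δ(τ)Δ(z)(j(τ)−j(z))‖ ≤ C|τ|²|z|²e^{−π Im z}`. [cite: CohnEtAl2019, Lemma 4.9 (4.16)] -/
theorem kernelMinus24_sub_G_bound_416 {δ : ℝ} (hδ : 0 < δ) (γ : SL(2, ℤ))
    (hγ : γ = 1 ∨ γ = ModularGroup.T ∨ γ = ModularGroup.T * ModularGroup.S) :
    ∃ C : ℝ, ∀ τ z : ℍ, δ ≤ τ.im → δ ≤ z.im →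
      ‖(((fun σ => kernelMinus24 σ z) ∣[(12 : ℤ)] γ) τ - minus24G (psi2 ∣[(2 : ℤ)] γ) (psi4 ∣[(4 : ℤ)] γ) τ z) *
        (ModularForm.discriminant τ * ModularForm.discriminant z * (kleinJ τ - kleinJ z))‖
          ≤ C * (‖(τ : ℂ)‖ ^ 2 * ‖(z : ℂ)‖ ^ 2 * expDecayHalf z) := by
  obtain ⟨hψ4, hψ2, _, _, _, h4T, h4TS⟩ := halfPlane_isBigO_psi hδ
  obtain ⟨_, _, _, _, _, _, _, _, hxi2, _, hxi2S, _⟩ := halfPlane_isBigO_theta hδ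
  obtain ⟨_, _, _, _, _, _, _, h1, _, _⟩ := halfPlane_isBigO_basic hδ
  have h2T : (psi2 + (π * I) • xi2) =O[𝓟 (halfPlane δ)] fun τ : ℍ => ‖(τ : ℂ)‖ := by
    have hx : xi2 =O[𝓟 (halfPlane δ)] fun τ : ℍ => ‖(τ : ℂ)‖ := by simpa using h1.mul hxi2
    exact (hψ2.add (hx.const_mul_left (π * I : ℂ))).congr_left fun τ => by simp [smul_eq_mul]
  have h2TS : (psi2 + (π * I) • xi2S) =O[𝓟 (halfPlane δ)] fun τ : ℍ => ‖(τ : ℂ)‖ := by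
    have hx : xi2S =O[𝓟 (halfPlane δ)] fun τ : ℍ => ‖(τ : ℂ)‖ := by simpa using h1.mul hxi2S
    exact (hψ2.add (hx.const_mul_left (π * I : ℂ))).congr_left fun τ => by simp [smul_eq_mul]
  have main : ∀ {R2 R4 : ℍ → ℂ}, psi2 ∣[(2 : ℤ)] γ = R2 → psi4 ∣[(4 : ℤ)] γ = R4 →
      R2 =O[𝓟 (halfPlane δ)] (fun τ : ℍ => ‖(τ : ℂ)‖) → R4 =O[𝓟 (halfPlane δ)] (fun τ : ℍ => ‖(τ : ℂ)‖) →
      ∃ C : ℝ, ∀ τ z : ℍ, δ ≤ τ.im → δ ≤ z.im →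
        ‖(((fun σ => kernelMinus24 σ z) ∣[(12 : ℤ)] γ) τ - minus24G (psi2 ∣[(2 : ℤ)] γ) (psi4 ∣[(4 : ℤ)] γ) τ z) *
          (ModularForm.discriminant τ * ModularForm.discriminant z * (kleinJ τ - kleinJ z))‖
            ≤ C * (‖(τ : ℂ)‖ ^ 2 * ‖(z : ℂ)‖ ^ 2 * expDecayHalf z) := by
    intro R2 R4 e2 e4 hR2 hR4
    have hw : ∀ p : ℍ × ℍ, 0 ≤ ‖(p.1 : ℂ)‖ * (‖(p.2 : ℂ)‖ * expDecayHalf p.2) := fun p =>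
      mul_nonneg (norm_nonneg _) (mul_nonneg (norm_nonneg _) (expDecayHalf_pos _).le)
    obtain ⟨C, hC⟩ := minus24Kernel_sub_G_bound_of_isBigO hw (minus24M_isBigO hδ hR2 hR4)
    refine ⟨|C| / δ ^ 2, fun τ z hτ hz => ?_⟩
    have h := hC τ z hτ hz
    rw [kernelMinus24_eq_minus24Kernel, minus24Kernel_slash, e2, e4]
    refine h.trans ?_
    have hb0 : 0 ≤ expDecayHalf z := (expDecayHalf_pos z).le
    have hX0 : 0 ≤ ‖(τ : ℂ)‖ * (‖(z : ℂ)‖ * expDecayHalf z) := hw (τ, z)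
    have hτ1 : δ ≤ ‖(τ : ℂ)‖ := hτ.trans (im_le_norm_coe τ)
    have hz1 : δ ≤ ‖(z : ℂ)‖ := hz.trans (im_le_norm_coe z)
    have h1' : C * (‖(τ : ℂ)‖ * (‖(z : ℂ)‖ * expDecayHalf z)) ≤ |C| * (‖(τ : ℂ)‖ * (‖(z : ℂ)‖ * expDecayHalf z)) :=
      mul_le_mul_of_nonneg_right (le_abs_self C) hX0
    refine h1'.trans ?_
    rw [show |C| / δ ^ 2 * (‖(τ : ℂ)‖ ^ 2 * ‖(z : ℂ)‖ ^ 2 * expDecayHalf z) =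
      |C| * (‖(τ : ℂ)‖ * (‖(z : ℂ)‖ * expDecayHalf z)) * ((‖(τ : ℂ)‖ / δ) * (‖(z : ℂ)‖ / δ)) by field_simp]
    refine le_mul_of_one_le_right (mul_nonneg (abs_nonneg C) hX0) ?_
    have a : 1 ≤ ‖(τ : ℂ)‖ / δ := by rw [le_div_iff₀ hδ]; linarith
    have b : 1 ≤ ‖(z : ℂ)‖ / δ := by rw [le_div_iff₀ hδ]; linarith
    nlinarith
  rcases hγ with rfl | rfl | rfl
  · exact main (by rw [SlashAction.slash_one]) (by rw [SlashAction.slash_one]) hψ2 hψ4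
  · obtain ⟨⟨hT2, hT4⟩, _, _⟩ := psi_rows_slash
    exact main hT2 hT4 h2T h4T
  · obtain ⟨_, hS2, hS4⟩ := psi_rows_slash
    exact main hS2 hS4 h2TS h4TS

end Literature.NumberTheory.ModularForms
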